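import Mathlib
import Literature.Computability.AlgebraicComplexity.BorderApolarityLimits
import Summits.MatrixMultiplication.MatrixMultiplication.Theorems.FidelityWitnessesFidelityGapThreeSeventeenStubBorelNormalFormLimits

/-!
# Borel normal form, part 2: the limit of a one-parameter family keeps the dimension

Support file for `stub_borelNormalForm` (line `symbolic-square-border-apolarity` of
`FidelityWitnesses.FidelityGapThreeSeventeen`).  For the lattice/limit formalism of part 1
(`BorelLimit.lat`, `BorelLimit.limW`): if the translate has a quasi-inverse (`Hb ∘ H = H ∘ Hb = ε^a`
on `S[ε]`), then `dim_K lim W = dim_K W` for every `W ≤ S`, `S` finite-dimensional.  Proof: coordinates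
`S ≅ K^n` transport the lattice to a lattice `⊆ K[ε]^n` whose `K(ε)`-span `Usp` has `dim_{K(ε)} = dim_K W`
(the translates of a basis of `W` form a `K(ε)`-basis) and whose coordinate limit is `lim W`; then
`finrank_limSub_eq` (`BorderApolarityLimits`, Smith normal form: the Grassmannian is proper).
General linear algebra, PROVED.  Refs: Conner–Harper–Landsberg, Forum Math. Pi 11 (2023) e17, §2.3–2.4.
-/

noncomputable section

namespace Summit.MatrixMultiplication.MatrixMultiplication.Theorems.SymbolicSquare

-- single-conjunct summit: the `Summit.<S>.<P>` prefix repeats `MatrixMultiplication` by design (D-0017)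
set_option linter.dupNamespace false

open scoped BigOperators Polynomial
open Polynomial

/-! ## The dimension of the limit: `dim lim W = dim W` (transport to `finrank_limSub_eq`) -/

namespace BorelLimit

open Literature.Computability.AlgebraicComplexity

universe u v

variable {K : Type u} [Field K] {σ : Type v}

section Coord

variable (V : Submodule K (MvPolynomial σ K))

/-- A complement of the subspace `V`. -/
def cpl : Submodule K (MvPolynomial σ K) := V.exists_isCompl.choose

/-- `cpl V` is a complement. -/
theorem isCompl_cpl : IsCompl V (cpl V) := V.exists_isCompl.choose_spec

variable [FiniteDimensional K V]

/-- Coordinates `P → K^n` (`n = dim V`) extending the coordinates of `V` in its `finBasis`. -/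
def crd : MvPolynomial σ K →ₗ[K] (Fin (Module.finrank K V) → K) :=
  (Module.finBasis K V).equivFun.toLinearMap ∘ₗ V.projectionOnto (cpl V) (isCompl_cpl V)

/-- The inverse coordinate map `K^n → V ⊆ P`. -/
def ucrd : (Fin (Module.finrank K V) → K) →ₗ[K] MvPolynomial σ K :=
  V.subtype ∘ₗ (Module.finBasis K V).equivFun.symm.toLinearMap

/-- `ucrd c = ∑ cᵢ bᵢ`. -/
theorem ucrd_apply (c : Fin (Module.finrank K V) → K) :
    ucrd V c = ∑ i, c i • (Module.finBasis K V i : MvPolynomial σ K) := by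
  simp [ucrd, Module.Basis.equivFun_symm_apply]

/-- `crd ∘ ucrd = id`. -/
theorem crd_ucrd (c : Fin (Module.finrank K V) → K) : crd V (ucrd V c) = c := by
  change (Module.finBasis K V).equivFun (V.projectionOnto (cpl V) (isCompl_cpl V)
    ((Module.finBasis K V).equivFun.symm c : V)) = c
  rw [Submodule.projectionOnto_apply_left, LinearEquiv.apply_symm_apply]

/-- `ucrd ∘ crd = id` on `V`. -/
theorem ucrd_crd {f : MvPolynomial σ K} (hf : f ∈ V) : ucrd V (crd V f) = f := by
  simp only [crd, ucrd, LinearMap.comp_apply, LinearEquiv.coe_coe, Submodule.subtype_apply]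
  have := Submodule.projectionOnto_apply_left (isCompl_cpl V) ⟨f, hf⟩
  rw [this]
  simp

/-- `ucrd` lands in `V`. -/
theorem ucrd_mem (c : Fin (Module.finrank K V) → K) : ucrd V c ∈ V := by
  simp only [ucrd, LinearMap.comp_apply, LinearEquiv.coe_coe, Submodule.subtype_apply]
  exact Submodule.coe_mem _

/-- Coordinates of families: `P[ε] → K[ε]^n`, coefficientwise. -/
def crdX : (MvPolynomial σ K)[X] →ₗ[K] (Fin (Module.finrank K V) → K[X]) :=
  LinearMap.pi fun i => cw ((LinearMap.proj i) ∘ₗ crd V)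

/-- Coefficients of `crdX`. -/
@[simp] theorem coeff_crdX (F : (MvPolynomial σ K)[X]) (i : Fin (Module.finrank K V)) (t : ℕ) :
    (crdX V F i).coeff t = crd V (F.coeff t) i := by
  simp [crdX]

/-- Families from coordinates: `K[ε]^n → V[ε] ⊆ P[ε]`, `f ↦ ∑ᵢ fᵢ(ε) bᵢ`. -/
def ucrdX : (Fin (Module.finrank K V) → K[X]) →ₗ[K] (MvPolynomial σ K)[X] :=
  ∑ i, LinearMap.mulRight K (C (Module.finBasis K V i : MvPolynomial σ K)) ∘ₗ
    (Polynomial.mapAlgHom (Algebra.ofId K (MvPolynomial σ K))).toLinearMap ∘ₗ LinearMap.proj i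

/-- Unfolding lemma for `ucrdX`. -/
theorem ucrdX_apply (f : Fin (Module.finrank K V) → K[X]) :
    ucrdX V f = ∑ i, (f i).map (algebraMap K (MvPolynomial σ K)) *
      C (Module.finBasis K V i : MvPolynomial σ K) := by
  simp only [ucrdX, LinearMap.coe_sum, Finset.sum_apply, LinearMap.comp_apply, LinearMap.proj_apply,
    AlgHom.toLinearMap_apply, LinearMap.mulRight_apply]
  rfl

/-- Coefficients of `ucrdX`. -/
theorem coeff_ucrdX (f : Fin (Module.finrank K V) → K[X]) (t : ℕ) :
    (ucrdX V f).coeff t = ucrd V (fun i => (f i).coeff t) := by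
  rw [ucrdX_apply, ucrd_apply, finsetSum_coeff]
  refine Finset.sum_congr rfl fun i _ => ?_
  rw [coeff_mul_C, coeff_map, Algebra.smul_def]

/-- `crdX ∘ ucrdX = id`. -/
theorem crdX_ucrdX (f : Fin (Module.finrank K V) → K[X]) : crdX V (ucrdX V f) = f := by
  funext i
  ext t
  rw [coeff_crdX, coeff_ucrdX, crd_ucrd]

/-- `ucrdX ∘ crdX = id` on `V[ε]`. -/
theorem ucrdX_crdX {F : (MvPolynomial σ K)[X]} (hF : F ∈ famOf V) : ucrdX V (crdX V F) = F := by
  ext t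
  rw [coeff_ucrdX]
  have : (fun i => (crdX V F i).coeff t) = crd V (F.coeff t) := by
    funext i; rw [coeff_crdX]
  rw [this, ucrd_crd V (hF t)]

/-- `ucrdX` lands in `V[ε]`. -/
theorem ucrdX_mem (f : Fin (Module.finrank K V) → K[X]) : ucrdX V f ∈ famOf V := by
  intro t
  rw [coeff_ucrdX]
  exact ucrd_mem V _

/-- `crdX` is `K[ε]`-linear. -/
theorem crdX_mapC_mul (p : K[X]) (F : (MvPolynomial σ K)[X]) :
    crdX V (p.map (algebraMap K (MvPolynomial σ K)) * F) = p • crdX V F := by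
  funext i
  change cw ((LinearMap.proj i) ∘ₗ crd V) _ = p * cw ((LinearMap.proj i) ∘ₗ crd V) F
  rw [cw_mapC_mul, Algebra.algebraMap_self, Polynomial.map_id]

/-- `crdX` is injective on `V[ε]`. -/
theorem crdX_injOn {F G : (MvPolynomial σ K)[X]} (hF : F ∈ famOf V) (hG : G ∈ famOf V)
    (h : crdX V F = crdX V G) : F = G := by
  rw [← ucrdX_crdX V hF, ← ucrdX_crdX V hG, h]

/-- Constant terms commute with coordinates. -/
theorem ev0_crdX (F : (MvPolynomial σ K)[X]) : ev0ₗ (K := K) (crdX V F) = crd V (F.coeff 0) := by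
  funext i
  rw [ev0ₗ_apply, coeff_crdX]

end Coord

section PolyVec

variable (L : Type*) [Field L] [Algebra K[X] L] {n : Type*}

/-- `polyVec` is `K[ε]`-semilinear. -/
theorem polyVec_smul (c : K[X]) (f : n → K[X]) :
    polyVec L (c • f) = algebraMap K[X] L c • polyVec L f := by
  funext j
  simp [polyVec]

/-- `polyVec 0 = 0`. -/
theorem polyVec_zero : polyVec L (0 : n → K[X]) = 0 := by
  funext j
  simp [polyVec]

/-- `polyVec` is additive over finite sums. -/
theorem polyVec_sum {ι : Type*} (s : Finset ι) (f : ι → n → K[X]) :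
    polyVec L (∑ i ∈ s, f i) = ∑ i ∈ s, polyVec L (f i) := by
  rw [← polyVecₗ_apply, map_sum]
  rfl

end PolyVec

section Main

variable (Hb H : (MvPolynomial σ K)[X] →ₗ[K] (MvPolynomial σ K)[X])
variable (hX : ∀ F, Hb (X * F) = X * Hb F) (hXH : ∀ F, H (X * F) = X * H F)
variable {S W : Submodule K (MvPolynomial σ K)} [FiniteDimensional K S]
variable (hWS : W ≤ S) (hHS : ∀ F ∈ famOf S, H F ∈ famOf S)
variable (a : ℕ) (h1 : ∀ F ∈ famOf S, Hb (H F) = X ^ a * F) (h2 : ∀ F ∈ famOf S, H (Hb F) = X ^ a * F)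

/-- The `L`-subspace spanned by the lattice, in coordinates (`L = K(ε)`). -/
def Usp (L : Type*) [Field L] [Algebra K[X] L] (S W : Submodule K (MvPolynomial σ K))
    [FiniteDimensional K S] : Submodule L (Fin (Module.finrank K S) → L) :=
  Submodule.span L ((fun F => polyVec L (crdX S F)) '' (lat Hb S W : Set (MvPolynomial σ K)[X]))

include hX in
/-- **The lattice of `Usp` is the coordinate image of `lat`** (clearing denominators + saturation). -/
theorem mem_latt_Usp_iff (L : Type*) [Field L] [Algebra K[X] L] [IsFractionRing K[X] L]
    (f : Fin (Module.finrank K S) → K[X]) :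
    f ∈ latt K L (Usp Hb L S W) ↔ ∃ F ∈ lat Hb S W, crdX S F = f := by
  constructor
  · intro hf
    rw [mem_latt, Usp, Submodule.mem_span_set'] at hf
    obtain ⟨k, g, v, hsum⟩ := hf
    have hv : ∀ i, ∃ F ∈ lat Hb S W, polyVec L (crdX S F) = (v i : Fin (Module.finrank K S) → L) :=
      fun i => (v i).2
    choose Fi hFi hFv using hv
    obtain ⟨b, hb⟩ := IsLocalization.exist_integer_multiples (nonZeroDivisors K[X]) Finset.univ g
    choose p hp using fun i => hb i (Finset.mem_univ i)
    have hb0 : (b : K[X]) ≠ 0 := nonZeroDivisors.coe_ne_zero b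
    -- `b • f = crdX G` with `G ∈ lat`
    set G : (MvPolynomial σ K)[X] := ∑ i, (p i).map (algebraMap K (MvPolynomial σ K)) * Fi i with hG
    have hGlat : G ∈ lat Hb S W := Submodule.sum_mem _ fun i _ => mapC_mul_mem_lat Hb hX (p i) (hFi i)
    have hbf : (b : K[X]) • f = crdX S G := by
      apply polyVec_injective L
      rw [polyVec_smul, hG, map_sum, polyVec_sum]
      simp_rw [crdX_mapC_mul, polyVec_smul]
      rw [← hsum, Finset.smul_sum]
      refine Finset.sum_congr rfl fun i _ => ?_
      rw [hFv i, hp i, Algebra.smul_def (b : K[X]) (g i), smul_smul]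
    -- saturation
    set F' := ucrdX S f with hF'
    have hF'S : F' ∈ famOf S := ucrdX_mem S f
    have hbF' : (b : K[X]).map (algebraMap K (MvPolynomial σ K)) * F' = G := by
      apply crdX_injOn S (mapC_mul_mem_famOf _ hF'S) hGlat.1
      rw [crdX_mapC_mul, hF', crdX_ucrdX, hbf]
    have hHbF' : Hb F' ∈ famOf W := by
      apply mem_famOf_of_mapC_mul_mem hb0
      rw [← map_mapC_mul Hb hX, hbF']
      exact hGlat.2
    exact ⟨F', (mem_lat Hb).2 ⟨hF'S, hHbF'⟩, by rw [hF', crdX_ucrdX]⟩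
  · rintro ⟨F, hF, rfl⟩
    rw [mem_latt]
    exact Submodule.subset_span ⟨F, hF, rfl⟩

include hX in
/-- The coordinate limit of `Usp` is the coordinate image of `lim W`. -/
theorem limSub_Usp_eq (L : Type*) [Field L] [Algebra K[X] L] [IsFractionRing K[X] L] :
    limSub K L (Usp Hb L S W) = (limW Hb S W).map (crd S) := by
  ext y
  rw [mem_limSub_iff, Submodule.mem_map]
  constructor
  · rintro ⟨f, hf, rfl⟩
    obtain ⟨F, hF, rfl⟩ := (mem_latt_Usp_iff Hb hX L f).1 hf
    exact ⟨F.coeff 0, coeff_zero_mem_limW Hb hF, (ev0_crdX S F).symm⟩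
  · rintro ⟨w, hw, rfl⟩
    obtain ⟨F, hF, rfl⟩ := (mem_limW Hb).1 hw
    exact ⟨crdX S F, (mem_latt_Usp_iff Hb hX L _).2 ⟨F, hF, rfl⟩, ev0_crdX S F⟩

/-- `dim_K (lim W) = dim_K` of its coordinate image. -/
theorem finrank_map_crd_limW : Module.finrank K ((limW Hb S W).map (crd S)) = Module.finrank K (limW Hb S W) := by
  rw [← LinearMap.range_domRestrict]
  apply LinearMap.finrank_range_of_inj
  rintro ⟨x, hx⟩ ⟨y, hy⟩ h
  simp only [LinearMap.domRestrict_apply] at h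
  have hx' := ucrd_crd S (limW_le Hb hx)
  have hy' := ucrd_crd S (limW_le Hb hy)
  apply Subtype.ext
  change x = y
  rw [← hx', ← hy', h]

include hXH hWS hHS h1 h2 in
/-- **`dim_L Usp = dim_K W`**: the translates `g · wⱼ` (`H (C wⱼ)`) of a basis of `W` form an
`L`-basis of `Usp`. -/
theorem finrank_Usp_eq (L : Type*) [Field L] [Algebra K[X] L] [IsFractionRing K[X] L] :
    Module.finrank L (Usp Hb L S W) = Module.finrank K W := by
  haveI : FiniteDimensional K W := Submodule.finiteDimensional_of_le hWS
  set d := Module.finrank K W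
  set bW := Module.finBasis K W
  set u : Fin d → (Fin (Module.finrank K S) → L) :=
    fun j => polyVec L (crdX S (H (C (bW j : MvPolynomial σ K)))) with hu
  -- (C1) the translates lie in the lattice
  have hlat : ∀ j, H (C (bW j : MvPolynomial σ K)) ∈ lat Hb S W := by
    intro j
    refine (mem_lat Hb).2 ⟨hHS _ (C_mem_famOf.2 (hWS (bW j).2)), ?_⟩
    rw [h1 _ (C_mem_famOf.2 (hWS (bW j).2))]
    exact (X_pow_mul_mem_famOf a).2 (C_mem_famOf.2 (bW j).2)
  have hXa : (X ^ a : K[X]).map (algebraMap K (MvPolynomial σ K)) = X ^ a := by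
    rw [Polynomial.map_pow, Polynomial.map_X]
  have hXa0 : algebraMap K[X] L (X ^ a) ≠ 0 := by
    intro h
    exact pow_ne_zero a Polynomial.X_ne_zero ((IsFractionRing.to_map_eq_zero_iff (K := L)).1 h)
  -- (C2) they span
  have hspan : Usp Hb L S W = Submodule.span L (Set.range u) := by
    apply le_antisymm
    · rw [Usp, Submodule.span_le]
      rintro _ ⟨F, hF, rfl⟩
      set q := crdX W (Hb F) with hq
      have hdec : Hb F = ∑ j, (q j).map (algebraMap K (MvPolynomial σ K)) * C (bW j : MvPolynomial σ K) := by
        rw [← ucrdX_apply, hq, ucrdX_crdX W hF.2]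
      have hkey : X ^ a * F = ∑ j, (q j).map (algebraMap K (MvPolynomial σ K)) *
          H (C (bW j : MvPolynomial σ K)) := by
        rw [← h2 F hF.1, hdec, map_sum]
        refine Finset.sum_congr rfl fun j _ => ?_
        rw [map_mapC_mul H hXH]
      have hvec : algebraMap K[X] L (X ^ a) • polyVec L (crdX S F) = ∑ j, algebraMap K[X] L (q j) • u j := by
        rw [← polyVec_smul, ← crdX_mapC_mul, hXa, hkey, map_sum, polyVec_sum]
        refine Finset.sum_congr rfl fun j _ => ?_
        rw [crdX_mapC_mul, polyVec_smul]
      have hmem : algebraMap K[X] L (X ^ a) • polyVec L (crdX S F) ∈ Submodule.span L (Set.range u) := by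
        rw [hvec]
        exact Submodule.sum_mem _ fun j _ => Submodule.smul_mem _ _ (Submodule.subset_span ⟨j, rfl⟩)
      have := Submodule.smul_mem _ (algebraMap K[X] L (X ^ a))⁻¹ hmem
      rwa [smul_smul, inv_mul_cancel₀ hXa0, one_smul] at this
    · rw [Submodule.span_le]
      rintro _ ⟨j, rfl⟩
      exact Submodule.subset_span ⟨_, hlat j, rfl⟩
  -- (C3) they are independent
  have hli : LinearIndependent L u := by
    rw [Fintype.linearIndependent_iff]
    intro g hg
    obtain ⟨b, hb⟩ := IsLocalization.exist_integer_multiples (nonZeroDivisors K[X]) Finset.univ g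
    choose p hp using fun i => hb i (Finset.mem_univ i)
    have hb0 : algebraMap K[X] L (b : K[X]) ≠ 0 :=
      IsFractionRing.to_map_ne_zero_of_mem_nonZeroDivisors b.2
    set G₀ : (MvPolynomial σ K)[X] := ucrdX W p with hG₀
    have hG₀W : G₀ ∈ famOf W := ucrdX_mem W p
    have hG₀S : G₀ ∈ famOf S := famOf_mono hWS hG₀W
    -- the cleared relation says `crdX (H G₀) = 0`
    have hrel : polyVec L (crdX S (H G₀)) = 0 := by
      have : H G₀ = ∑ j, (p j).map (algebraMap K (MvPolynomial σ K)) * H (C (bW j : MvPolynomial σ K)) := by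
        rw [hG₀, ucrdX_apply, map_sum]
        refine Finset.sum_congr rfl fun j _ => ?_
        rw [map_mapC_mul H hXH]
      rw [this, map_sum, polyVec_sum]
      simp_rw [crdX_mapC_mul, polyVec_smul]
      calc ∑ j, algebraMap K[X] L (p j) • u j = ∑ j, (algebraMap K[X] L b) • (g j • u j) := by
            refine Finset.sum_congr rfl fun j _ => ?_
            rw [hp j, Algebra.smul_def (b : K[X]) (g j), smul_smul]
        _ = 0 := by rw [← Finset.smul_sum, hg, smul_zero]
    have hH0 : H G₀ = 0 := by
      have h0 : crdX S (H G₀) = 0 := polyVec_injective L (hrel.trans (polyVec_zero L).symm)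
      rw [← ucrdX_crdX S (hHS _ hG₀S), h0, map_zero]
    have hG₀0 : G₀ = 0 := by
      have := h1 G₀ hG₀S
      rw [hH0, map_zero] at this
      exact (mul_eq_zero.1 this.symm).resolve_left (pow_ne_zero a Polynomial.X_ne_zero)
    have hp0 : p = 0 := by
      rw [← crdX_ucrdX W p, ← hG₀, hG₀0, map_zero]
    intro j
    have hj := hp j
    rw [hp0, Pi.zero_apply, map_zero, Algebra.smul_def] at hj
    exact (mul_eq_zero.1 hj.symm).resolve_left hb0
  rw [hspan, finrank_span_eq_card hli, Fintype.card_fin]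

include hX hXH hWS hHS h1 h2 in
/-- **The limit has the dimension of the original subspace**: `dim_K lim W = dim_K W` (through
`finrank_limSub_eq`: the Grassmannian is proper). -/
theorem finrank_limW_eq : Module.finrank K (limW Hb S W) = Module.finrank K W := by
  let L := FractionRing K[X]
  rw [← finrank_Usp_eq Hb H hXH hWS hHS a h1 h2 L, ← finrank_limSub_eq K L (Usp Hb L S W),
    limSub_Usp_eq Hb hX L, finrank_map_crd_limW]

end Main

end BorelLimit


/-- **Part 2 of `stub_borelNormalForm` (registered helper stub): the limit keeps the dimension.**
If `Hb`, `H` commute with `ε`, `H` preserves `S[ε]`, and `Hb ∘ H = H ∘ Hb = ε^a` on `S[ε]`, then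
`dim_K lim W = dim_K W` for `W ≤ S` finite-dimensional. -/
theorem stub_borelNormalForm_rank : ∀ {K : Type} [Field K] {σ : Type}
    (Hb H : Polynomial (MvPolynomial σ K) →ₗ[K] Polynomial (MvPolynomial σ K))
    {S W : Submodule K (MvPolynomial σ K)} [FiniteDimensional K S] (a : ℕ),
    (∀ F, Hb (Polynomial.X * F) = Polynomial.X * Hb F) → (∀ F, H (Polynomial.X * F) = Polynomial.X * H F) →
    W ≤ S → (∀ F ∈ BorelLimit.famOf S, H F ∈ BorelLimit.famOf S) →
    (∀ F ∈ BorelLimit.famOf S, Hb (H F) = Polynomial.X ^ a * F) →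
    (∀ F ∈ BorelLimit.famOf S, H (Hb F) = Polynomial.X ^ a * F) →
    Module.finrank K (BorelLimit.limW Hb S W) = Module.finrank K W :=
  fun Hb H _ _ _ a hX hXH hWS hHS h1 h2 => BorelLimit.finrank_limW_eq Hb H hX hXH hWS hHS a h1 h2

end Summit.MatrixMultiplication.MatrixMultiplication.Theorems.SymbolicSquare

end
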